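import Summits.QuantumFields.YangMills.Theorems.ColdStartUniversalityLatticeLangevinPathIntegralMarkov
import Summits.QuantumFields.YangMills.Theorems.ColdStartUniversalityLatticeLangevinTimeDecorrelation
import Summits.QuantumFields.YangMills.Theorems.ColdStartUniversalityLatticeLangevinGreenKuboLemma
import Summits.QuantumFields.YangMills.Theorems.ColdStartUniversalityLatticeLangevinRegularFlow
import Summits.QuantumFields.YangMills.Theorems.ColdStartUniversalityLatticeLangevinSplice
import HarnessLib

/-!
# Route `ColdStartUniversality` (fixed-cut-off SZZ dynamics, sampler package): THE INITIALISATION BIAS OF THE COLD START —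
# `E[∫₀ᵀ Ĝ(U_r)dr] = ∫₀ᵀ κ_rĜ(x)dr = u(x) + O(e^(−cT))`: bias `u(x)/T = O(1/T)` ≪ statistical error `σ/√T`; burn-in `b` leaves `O(e^(−cb))/(T−b)`

Helper file (seat `ym-line-csu-p1`, g35; `--supports stmt-QuantumFields-24809`).  The practitioners' «thermalisation» question at fixed cut-off:
how biased is the time average of ONE run started COLD?  For the SU(2) SZZ dynamics at any coupling there are `C, c > 0` (`L, β'` only) such
that for every realising kernel family, EVERY strong solution `U` from EVERY deterministic start `x` on ANY space and every continuous `|G| ≤ 1`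
(`Ĝ = G − μ_(β')G`, `κ_rĜ(x) = E[Ĝ(U_r)]`):
* ★★ `integral_timeIntegral_eq_setIntegral_transition` — `E[∫_(0,T] Ĝ(U_r) dr] = ∫_(0,T] κ_rĜ(x) dr` (time-integrated Markov property);
* ★★★ `abs_bias_timeIntegral_sub_le` — `|E[∫_(0,T] Ĝ(U_r)dr] − ∫_(0,∞) κ_rĜ(x) dr| ≤ (C/c)·e^(−cT)`: the total bias of the run converges
  exponentially fast to the CORRECTOR AT THE START `u(x) = ∫₀^∞ κ_rĜ(x) dr` (`|u(x)| ≤ C/c`), so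
  ★★★ `abs_bias_timeAverage_le` — `|E[T⁻¹∫_(0,T] G(U_r)dr] − μ_(β')G| ≤ (C/c)/T`: the systematic error of the cold start is `O(1/T)`, one
  order smaller than the statistical error `σ(G)/√T` of the CLT (file 94c) — asymptotically NO BURN-IN IS NEEDED;
* ★★ `abs_bias_burnIn_le` — discarding an initial segment of length `b`: `|E[∫_(b,T] Ĝ(U_r)dr]| ≤ (C/c)·e^(−cb)`, i.e. the bias of the
  time average over `(b, T]` is at most `(C/c)e^(−cb)/(T − b)`.
THEOREMS ONLY, no definition, no sorry; [folklore] (initialisation bias of MCMC time averages; cf. [cite: GlynnOrmoneit2002, Theorem 2]).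
HONEST FRAMING: fixed cut-off; `C, c` depend on `L, β'`; `UniformColdStartMixing` (24809) is NOT restated; no crux, rung or summit statement is
proved; the Yang–Mills mass gap is NOT proved.
-/

set_option autoImplicit false

noncomputable section

namespace Summit.QuantumFields.YangMills.Theorems.ColdStartUniversality

open MeasureTheory ProbabilityTheory Filter Topology Set
open scoped NNReal ENNReal BigOperators
open Literature Literature.Probability.Process Literature.MathematicalPhysics.QuantumFieldTheory
open Literature.MathematicalPhysics.QuantumLattice (fundamentalRep fundamentalLatticeRep continuous_fundamentalRep)

variable {L : ℕ} [NeZero L]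

/-- ★★★ **Initialisation bias of the cold-start sampler.**  There are `C, c > 0` such that for every realising kernel family, every strong solution
`U` from a deterministic start `x` on any space, every continuous `|G| ≤ 1` and all `0 ≤ b ≤ T`, with `Ĝ = G − μ_(β')G` and `a(r) = ∫ Ĝ dκ_r(x)`:
(i) `E[∫_(0,T] Ĝ(U_r)dr] = ∫_(0,T] a`; (ii) `|E[∫_(0,T] Ĝ(U_r)dr] − ∫_(0,∞) a| ≤ (C/c)e^(−cT)` and `|∫_(0,∞) a| ≤ C/c`;
(iii) `|E[T⁻¹∫_(0,T] G(U_r)dr] − μ_(β')G| ≤ (C/c)/T` (`T > 0`); (iv) burn-in: `|E[∫_(b,T] Ĝ(U_r)dr]| ≤ (C/c)e^(−cb)`. [folklore] -/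
theorem abs_bias_timeIntegral_sub_le (L : ℕ) [NeZero L] (β' : ℝ) :
    ∃ C c : ℝ, 0 < C ∧ 0 < c ∧
      ∀ (κ : ℝ≥0 → Kernel (GaugeConfig 3 L (Matrix.specialUnitaryGroup (Fin 2) ℂ))
          (GaugeConfig 3 L (Matrix.specialUnitaryGroup (Fin 2) ℂ))) [∀ t, IsMarkovKernel (κ t)],
        (∀ (t : ℝ≥0) (x : GaugeConfig 3 L (Matrix.specialUnitaryGroup (Fin 2) ℂ))
          (Ω : Type) [MeasurableSpace Ω] (P : Measure Ω) [IsProbabilityMeasure P]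
          (W : ℝ≥0 → Ω → (Edge 3 L × NoiseIdx 2 → ℝ)) (hW : IsFlatBrownian W P)
          (U : ℝ≥0 → Ω → GaugeConfig 3 L (Matrix.specialUnitaryGroup (Fin 2) ℂ)),
          (∀ ω, U 0 ω = x) →
          (latticeLangevinDynamics (fundamentalLatticeRep 2) β').IsSolution (fundamentalRep (Fin 2))
            hW.natFiltration P W U →
          κ t x = P.map (U t)) →
        ∀ (x : GaugeConfig 3 L (Matrix.specialUnitaryGroup (Fin 2) ℂ))
          (Ω : Type) [MeasurableSpace Ω] (P : Measure Ω) [IsProbabilityMeasure P]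
          (W : ℝ≥0 → Ω → (Edge 3 L × NoiseIdx 2 → ℝ)) (hW : IsFlatBrownian W P)
          (U : ℝ≥0 → Ω → GaugeConfig 3 L (Matrix.specialUnitaryGroup (Fin 2) ℂ)),
          (∀ ω, U 0 ω = x) →
          (latticeLangevinDynamics (fundamentalLatticeRep 2) β').IsSolution (fundamentalRep (Fin 2)) hW.natFiltration P W U →
        ∀ (G : GaugeConfig 3 L (Matrix.specialUnitaryGroup (Fin 2) ℂ) → ℝ), Continuous G → (∀ z, |G z| ≤ 1) →
        ∀ (b T : ℝ), 0 ≤ b → b ≤ T →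
          (∫ ω, (∫ r in Ioc (0 : ℝ) T, (G (U r.toNNReal ω) - ∫ z, G z ∂(wilsonMeasure (d := 3) (L := L) (fundamentalRep (Fin 2)) β'))) ∂P =
            ∫ r in Ioc (0 : ℝ) T, (∫ z, (G z - ∫ z', G z' ∂(wilsonMeasure (d := 3) (L := L) (fundamentalRep (Fin 2)) β')) ∂(κ r.toNNReal x))) ∧
          |(∫ ω, (∫ r in Ioc (0 : ℝ) T, (G (U r.toNNReal ω) - ∫ z, G z ∂(wilsonMeasure (d := 3) (L := L) (fundamentalRep (Fin 2)) β'))) ∂P) -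
              ∫ r in Ioi (0 : ℝ), (∫ z, (G z - ∫ z', G z' ∂(wilsonMeasure (d := 3) (L := L) (fundamentalRep (Fin 2)) β')) ∂(κ r.toNNReal x))|
            ≤ C / c * Real.exp (-c * T) ∧
          |∫ r in Ioi (0 : ℝ), (∫ z, (G z - ∫ z', G z' ∂(wilsonMeasure (d := 3) (L := L) (fundamentalRep (Fin 2)) β')) ∂(κ r.toNNReal x))| ≤ C / c ∧
          (0 < T → |(∫ ω, T⁻¹ * (∫ r in Ioc (0 : ℝ) T, G (U r.toNNReal ω)) ∂P) -
              ∫ z, G z ∂(wilsonMeasure (d := 3) (L := L) (fundamentalRep (Fin 2)) β')| ≤ C / c / T) ∧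
          |∫ ω, (∫ r in Ioc b T, (G (U r.toNNReal ω) - ∫ z, G z ∂(wilsonMeasure (d := 3) (L := L) (fundamentalRep (Fin 2)) β'))) ∂P|
            ≤ C / c * Real.exp (-c * b) := by
  classical
  haveI := secondCountableTopology_su2
  haveI := borelSpace_config L
  obtain ⟨C, c, hC, hc, hmix⟩ := abs_transition_sub_wilson_le_exp L β'
  refine ⟨C, c, hC, hc, fun κ _ hreal x Ω _ P _ W hW U hU0 hU G hGc hG1 b T hb hbT => ?_⟩
  set μ : Measure (GaugeConfig 3 L (Matrix.specialUnitaryGroup (Fin 2) ℂ)) :=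
    wilsonMeasure (d := 3) (L := L) (fundamentalRep (Fin 2)) β' with hμ
  haveI : IsProbabilityMeasure μ :=
    isProbabilityMeasure_wilsonMeasure (d := 3) (L := L) (fundamentalRep (Fin 2)) (continuous_fundamentalRep (Fin 2)) β'
  set m : ℝ := ∫ z, G z ∂μ with hm
  have hG : Measurable G := hGc.measurable
  set Gh : GaugeConfig 3 L (Matrix.specialUnitaryGroup (Fin 2) ℂ) → ℝ := fun z => G z - m with hGh
  have hGhc : Continuous Gh := hGc.sub continuous_const
  have hm1 : |m| ≤ 1 := by
    have hh := norm_integral_le_of_norm_le_const (μ := μ) (f := G) (C := 1)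
      (Eventually.of_forall fun z => by simpa [Real.norm_eq_abs] using hG1 z)
    simpa [Real.norm_eq_abs] using hh
  have hGhb : ∀ z, |Gh z| ≤ 2 := fun z => (abs_sub _ _).trans (by linarith [hG1 z, hm1])
  have hT0 : 0 ≤ T := hb.trans hbT
  -- the kernel action `a r = κ_r Ĝ(x)` and its exponential bound
  have hGi : ∀ (ν : Measure (GaugeConfig 3 L (Matrix.specialUnitaryGroup (Fin 2) ℂ))) [IsProbabilityMeasure ν], Integrable G ν := fun ν _ =>
    (integrable_const (1 : ℝ)).mono' hG.aestronglyMeasurable (Eventually.of_forall fun z => by simpa [Real.norm_eq_abs] using hG1 z)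
  set a : ℝ → ℝ := fun r => ∫ z, Gh z ∂(κ r.toNNReal x) with ha
  have ha_eq : ∀ r, a r = (∫ z, G z ∂(κ r.toNNReal x)) - m := fun r => by
    simp only [ha, hGh]; rw [integral_sub (hGi _) (integrable_const m), integral_const, smul_eq_mul, probReal_univ, one_mul]
  have hab : ∀ r : ℝ, 0 ≤ r → |a r| ≤ C * Real.exp (-c * r) := fun r hr => by
    rw [ha_eq]
    have h := hmix κ hreal G hG hG1 r.toNNReal x
    rwa [Real.coe_toNNReal r hr] at h
  have hac : Continuous a := (continuous_transitionKernel_action β' κ hreal hGhc).comp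
    (continuous_real_toNNReal.prodMk continuous_const)
  have haiIoi : ∀ s : ℝ, 0 ≤ s → IntegrableOn a (Ioi s) := fun s hs => by
    have hbi : IntegrableOn (fun r : ℝ => C * Real.exp (-c * r)) (Ioi s) := (exp_neg_integrableOn_Ioi s hc).const_mul C
    refine Integrable.mono' hbi hac.aestronglyMeasurable ?_
    filter_upwards [ae_restrict_mem measurableSet_Ioi] with r hr
    rw [Real.norm_eq_abs]; exact hab r (hs.trans hr.le)
  have htail : ∀ s : ℝ, 0 ≤ s → |∫ r in Ioi s, a r| ≤ C / c * Real.exp (-c * s) := fun s hs => by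
    calc |∫ r in Ioi s, a r| ≤ ∫ r in Ioi s, |a r| := abs_integral_le_integral_abs
      _ ≤ ∫ r in Ioi s, C * Real.exp (-c * r) :=
          setIntegral_mono_on (haiIoi s hs).abs ((exp_neg_integrableOn_Ioi s hc).const_mul C) measurableSet_Ioi
            fun r hr => hab r (hs.trans hr.le)
      _ = C / c * Real.exp (-c * s) := by rw [integral_const_mul, setIntegral_Ioi_exp_neg_mul hc]; ring
  /- ### 1. The regular flow and the time-integrated Markov property -/
  obtain ⟨V, -, hV, hVprog, -, -, -⟩ := exists_regularFlow L β' hW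
  have hprog : ∀ i : ℝ≥0, Measurable[@Prod.instMeasurableSpace (Set.Iic i) Ω inferInstance (hW.natFiltration i)]
      (fun q : Set.Iic i × Ω => V x q.1 q.2) := fun i =>
    (hVprog i).comp (measurable_fst.prodMk (measurable_const.prodMk measurable_snd))
  have hae : ∀ᵐ ω ∂P, ∀ t, U t ω = V x t ω := latticeLangevin_pathwise_unique hW β' x hU0 (hV x).1 hU (hV x).2
  have hpathm : Measurable fun q : Ω × ℝ => V x q.2.toNNReal q.1 :=
    measurable_uncurry_of_prog (Z := V x) (fun n : ℕ => hW.natFiltration n) (fun n => hW.natFiltration.le n) (fun n => hprog n)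
  have hmarkov : ∀ τ : ℝ, 0 ≤ τ → ∫ ω, (∫ r in Ioc (0 : ℝ) τ, Gh (V x r.toNNReal ω)) ∂P = ∫ r in Ioc (0 : ℝ) τ, a r := by
    intro τ hτ
    have h := integral_mul_setIntegral_comp_eq_integral_mul_setIntegral_transition β' κ hreal x hW (hV x).1 (hV x).2 hpathm 0 hτ
      (Z := fun _ => (1 : ℝ)) measurable_const (CZ := 1) (fun _ => by norm_num) hGhc hGhb
    simp only [NNReal.coe_zero, zero_add, one_mul] at h
    have h2 : (fun ω => ∫ v in Ioc (0 : ℝ) τ, ∫ z, Gh z ∂(κ v.toNNReal (V x 0 ω))) = fun _ => ∫ r in Ioc (0 : ℝ) τ, a r := by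
      funext ω; simp only [ha, (hV x).1 ω]
    rw [h, h2, integral_const, smul_eq_mul, probReal_univ, one_mul]
  -- transfer `U ↦ V` inside the expectations
  have htransfer : ∀ s t : ℝ, ∫ ω, (∫ r in Ioc s t, Gh (U r.toNNReal ω)) ∂P = ∫ ω, (∫ r in Ioc s t, Gh (V x r.toNNReal ω)) ∂P := fun s t =>
    integral_congr_ae (by
      filter_upwards [hae] with ω hω
      have : (fun r : ℝ => Gh (U r.toNNReal ω)) = fun r : ℝ => Gh (V x r.toNNReal ω) := funext fun r => by rw [hω]
      rw [this])
  /- ### 2. The statements -/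
  have hI : ∫ ω, (∫ r in Ioc (0 : ℝ) T, Gh (U r.toNNReal ω)) ∂P = ∫ r in Ioc (0 : ℝ) T, a r := by rw [htransfer, hmarkov T hT0]
  have hsplit : ∫ r in Ioi (0 : ℝ), a r = (∫ r in Ioc (0 : ℝ) T, a r) + ∫ r in Ioi T, a r := by
    have hun : Ioi (0 : ℝ) = Ioc (0 : ℝ) T ∪ Ioi T := (Ioc_union_Ioi_eq_Ioi hT0).symm
    have hdis : Disjoint (Ioc (0 : ℝ) T) (Ioi T) := Set.disjoint_left.2 fun r hr hr' => not_lt.2 hr.2 hr'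
    rw [hun, setIntegral_union hdis measurableSet_Ioi ((haiIoi 0 le_rfl).mono_set Ioc_subset_Ioi_self)
      ((haiIoi 0 le_rfl).mono_set (Ioi_subset_Ioi hT0))]
  have hII : |(∫ ω, (∫ r in Ioc (0 : ℝ) T, Gh (U r.toNNReal ω)) ∂P) - ∫ r in Ioi (0 : ℝ), a r| ≤ C / c * Real.exp (-c * T) := by
    rw [hI, hsplit, show (∫ r in Ioc (0 : ℝ) T, a r) - ((∫ r in Ioc (0 : ℝ) T, a r) + ∫ r in Ioi T, a r) = -∫ r in Ioi T, a r by ring, abs_neg]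
    exact htail T hT0
  have hu : |∫ r in Ioi (0 : ℝ), a r| ≤ C / c := by
    have h := htail 0 le_rfl
    rwa [mul_zero, Real.exp_zero, mul_one] at h
  refine ⟨hI, hII, hu, fun hT => ?_, ?_⟩
  · -- (iii) bias of the time average
    have hIoc : |∫ r in Ioc (0 : ℝ) T, a r| ≤ C / c := by
      calc |∫ r in Ioc (0 : ℝ) T, a r| ≤ ∫ r in Ioc (0 : ℝ) T, |a r| := abs_integral_le_integral_abs
        _ ≤ ∫ r in Ioi (0 : ℝ), |a r| := setIntegral_mono_set (haiIoi 0 le_rfl).abs (Eventually.of_forall fun r => abs_nonneg _)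
            (Eventually.of_forall Ioc_subset_Ioi_self)
        _ ≤ ∫ r in Ioi (0 : ℝ), C * Real.exp (-c * r) :=
            setIntegral_mono_on (haiIoi 0 le_rfl).abs ((exp_neg_integrableOn_Ioi 0 hc).const_mul C) measurableSet_Ioi
              fun r hr => hab r hr.le
        _ = C / c := by rw [integral_const_mul, setIntegral_Ioi_exp_neg_mul hc, mul_zero, Real.exp_zero]; ring
    -- `E[T⁻¹∫ G] − m = T⁻¹ E[∫ Ĝ]`
    have hpath : ∀ ω, IntegrableOn (fun r : ℝ => G (V x r.toNNReal ω)) (Ioc (0 : ℝ) T) volume := fun ω =>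
      (integrableOn_const (C := (1 : ℝ)) (hs := measure_Ioc_lt_top.ne)).mono'
        ((hG.comp (hpathm.comp (measurable_const.prodMk measurable_id))).aestronglyMeasurable)
        (Eventually.of_forall fun r => by rw [Real.norm_eq_abs]; exact hG1 _)
    have hGhI : ∀ ω, ∫ r in Ioc (0 : ℝ) T, Gh (V x r.toNNReal ω) = (∫ r in Ioc (0 : ℝ) T, G (V x r.toNNReal ω)) - m * T := fun ω => by
      simp only [hGh]
      rw [integral_sub (hpath ω) (integrableOn_const (hs := measure_Ioc_lt_top.ne)), setIntegral_const, smul_eq_mul,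
        Real.volume_real_Ioc_of_le hT0, sub_zero, mul_comm]
    have hIm : Measurable fun ω => ∫ r in Ioc (0 : ℝ) T, G (V x r.toNNReal ω) := by
      have h1 : Measurable (Function.uncurry fun (ω : Ω) (r : ℝ) => G (V x r.toNNReal ω)) := hG.comp hpathm
      exact (h1.stronglyMeasurable.integral_prod_right' (ν := volume.restrict (Ioc (0 : ℝ) T))).measurable
    have hIb : ∀ ω, |∫ r in Ioc (0 : ℝ) T, G (V x r.toNNReal ω)| ≤ T := fun ω => by
      have hh := norm_setIntegral_le_of_norm_le_const (μ := volume) (s := Ioc (0 : ℝ) T) measure_Ioc_lt_top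
        (fun r _ => show ‖G (V x r.toNNReal ω)‖ ≤ 1 by rw [Real.norm_eq_abs]; exact hG1 _) (f := fun r => G (V x r.toNNReal ω))
      rw [Real.norm_eq_abs, Real.volume_real_Ioc_of_le hT0, sub_zero, one_mul] at hh
      exact hh
    have iI : Integrable (fun ω => ∫ r in Ioc (0 : ℝ) T, G (V x r.toNNReal ω)) P :=
      (integrable_const T).mono' hIm.aestronglyMeasurable (Eventually.of_forall fun ω => by rw [Real.norm_eq_abs]; exact hIb ω)
    have hEG : ∫ ω, T⁻¹ * (∫ r in Ioc (0 : ℝ) T, G (U r.toNNReal ω)) ∂P - m = T⁻¹ * ∫ ω, (∫ r in Ioc (0 : ℝ) T, Gh (U r.toNNReal ω)) ∂P := by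
      have h1 : ∫ ω, T⁻¹ * (∫ r in Ioc (0 : ℝ) T, G (U r.toNNReal ω)) ∂P = ∫ ω, T⁻¹ * (∫ r in Ioc (0 : ℝ) T, G (V x r.toNNReal ω)) ∂P :=
        integral_congr_ae (by
          filter_upwards [hae] with ω hω
          have : (fun r : ℝ => G (U r.toNNReal ω)) = fun r : ℝ => G (V x r.toNNReal ω) := funext fun r => by rw [hω]
          rw [this])
      rw [h1, htransfer, integral_const_mul, integral_congr_ae (ae_of_all _ hGhI), integral_sub iI (integrable_const _), integral_const,
        smul_eq_mul, probReal_univ, one_mul]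
      field_simp
    rw [hEG, abs_mul, abs_inv, abs_of_pos hT, hI]
    calc T⁻¹ * |∫ r in Ioc (0 : ℝ) T, a r| ≤ T⁻¹ * (C / c) := mul_le_mul_of_nonneg_left hIoc (inv_nonneg.2 hT.le)
      _ = C / c / T := by rw [inv_mul_eq_div]
  · -- (iv) burn-in
    have hIb' : ∫ ω, (∫ r in Ioc b T, Gh (U r.toNNReal ω)) ∂P = ∫ r in Ioc b T, a r := by
      rw [htransfer]
      have hpath : ∀ ω, IntegrableOn (fun r : ℝ => Gh (V x r.toNNReal ω)) (Ioc (0 : ℝ) T) volume := fun ω =>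
        (integrableOn_const (C := (2 : ℝ)) (hs := measure_Ioc_lt_top.ne)).mono'
          ((hGhc.measurable.comp (hpathm.comp (measurable_const.prodMk measurable_id))).aestronglyMeasurable)
          (Eventually.of_forall fun r => by rw [Real.norm_eq_abs]; exact hGhb _)
      have hsplitω : ∀ ω, ∫ r in Ioc b T, Gh (V x r.toNNReal ω) =
          (∫ r in Ioc (0 : ℝ) T, Gh (V x r.toNNReal ω)) - ∫ r in Ioc (0 : ℝ) b, Gh (V x r.toNNReal ω) := fun ω => by
        rw [← Ioc_union_Ioc_eq_Ioc hb hbT, setIntegral_union (Ioc_disjoint_Ioc_of_le le_rfl) measurableSet_Ioc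
          ((hpath ω).mono_set (Ioc_subset_Ioc_right hbT)) ((hpath ω).mono_set (Ioc_subset_Ioc_left hb))]
        ring
      have hIm' : ∀ t, Measurable fun ω => ∫ r in Ioc (0 : ℝ) t, Gh (V x r.toNNReal ω) := fun t => by
        have h1 : Measurable (Function.uncurry fun (ω : Ω) (r : ℝ) => Gh (V x r.toNNReal ω)) := hGhc.measurable.comp hpathm
        exact (h1.stronglyMeasurable.integral_prod_right' (ν := volume.restrict (Ioc (0 : ℝ) t))).measurable
      have hIbd : ∀ t, 0 ≤ t → ∀ ω, |∫ r in Ioc (0 : ℝ) t, Gh (V x r.toNNReal ω)| ≤ 2 * t := fun t ht ω => by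
        have hh := norm_setIntegral_le_of_norm_le_const (μ := volume) (s := Ioc (0 : ℝ) t) measure_Ioc_lt_top
          (fun r _ => show ‖Gh (V x r.toNNReal ω)‖ ≤ 2 by rw [Real.norm_eq_abs]; exact hGhb _) (f := fun r => Gh (V x r.toNNReal ω))
        rw [Real.norm_eq_abs, Real.volume_real_Ioc_of_le ht, sub_zero] at hh
        linarith
      have iT : Integrable (fun ω => ∫ r in Ioc (0 : ℝ) T, Gh (V x r.toNNReal ω)) P :=
        (integrable_const (2 * T)).mono' (hIm' T).aestronglyMeasurable (Eventually.of_forall fun ω => by rw [Real.norm_eq_abs]; exact hIbd T hT0 ω)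
      have ib : Integrable (fun ω => ∫ r in Ioc (0 : ℝ) b, Gh (V x r.toNNReal ω)) P :=
        (integrable_const (2 * b)).mono' (hIm' b).aestronglyMeasurable (Eventually.of_forall fun ω => by rw [Real.norm_eq_abs]; exact hIbd b hb ω)
      rw [integral_congr_ae (ae_of_all _ hsplitω), integral_sub iT ib, hmarkov T hT0, hmarkov b hb,
        ← Ioc_union_Ioc_eq_Ioc hb hbT, setIntegral_union (Ioc_disjoint_Ioc_of_le le_rfl) measurableSet_Ioc
          ((haiIoi 0 le_rfl).mono_set (Ioc_subset_Ioi_self.trans (Ioi_subset_Ioi le_rfl)))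
          ((haiIoi 0 le_rfl).mono_set fun r hr => lt_of_le_of_lt hb hr.1)]
      ring
    rw [hIb']
    calc |∫ r in Ioc b T, a r| ≤ ∫ r in Ioc b T, |a r| := abs_integral_le_integral_abs
      _ ≤ ∫ r in Ioi b, |a r| := setIntegral_mono_set (haiIoi b hb).abs (Eventually.of_forall fun r => abs_nonneg _)
          (Eventually.of_forall Ioc_subset_Ioi_self)
      _ ≤ ∫ r in Ioi b, C * Real.exp (-c * r) :=
          setIntegral_mono_on (haiIoi b hb).abs ((exp_neg_integrableOn_Ioi b hc).const_mul C) measurableSet_Ioi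
            fun r hr => hab r (hb.trans hr.le)
      _ = C / c * Real.exp (-c * b) := by rw [integral_const_mul, setIntegral_Ioi_exp_neg_mul hc]; ring

end Summit.QuantumFields.YangMills.Theorems.ColdStartUniversality

end
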